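import Literature.Probability.RandomPlanarGeometry.SLETraceMeasurable
import HarnessLib

/-!
# Scale invariance in law of the SLE trace (`identDistrib_sleTrace_scale`) from trace existence

Trunk T-STOCH. The named fact `Literature.Probability.RandomPlanarGeometry.identDistrib_sleTrace_scale`
(`Literature/Probability/RandomPlanarGeometry/SLEProofs.lean`; Lawler (2005), Prop. 6.5;
Rohde–Schramm (2005), Prop. 2.1 (i)) asserts, for every `κ : ℝ≥0` and `c > 0`, the identity in
law of the random paths `t ↦ γ(t)` and `t ↦ c γ(t / c²)` (`γ = sleTrace κ ω`) on the path space
`ℝ≥0 → ℂ` with the product σ-algebra. We **prove** it for every `κ` for which SLE_κ is a.s.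
generated by a curve (`HasSLETrace κ`), hence — from the two trace theorems `hasSLETrace_eight`
(Lawler–Schramm–Werner (2004), Thm. 4.7) and `hasSLETrace_of_ne_eight` (Rohde–Schramm (2005),
Thm. 5.1) — in full (`identDistrib_sleTrace_scale_of_trace_theorems`).

The printed proof (Lawler (2005), proof of Prop. 6.5: "this follows from the scaling of
Brownian motion and of the Loewner equation") has a deterministic half and a probabilistic half.

* Deterministic half (in the tree): Brownian-type scaling of Loewner hulls
  (`Loewner.hull_scale_holds`), of generating curves (`Loewner.IsGeneratedByCurve.scale`) and,
  by uniqueness of the generating curve (`Loewner.IsGeneratedByCurve.unique_holds`), of the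
  trace: `trace (s ↦ c W(s/c²)) = s ↦ c · trace W (s/c²)` (`Loewner.trace_scale_of_unique`).
* Probabilistic half: Brownian scaling of the driving function
  (`identDistrib_sleDriving_scale_holds`: `W` and `S W := s ↦ c W(s/c²)` have the same law on
  the path space) is pushed through a **measurable** functional `T` of the driving path which
  agrees with the Loewner trace on every continuous path generated by a curve
  (`Loewner.exists_measurable_eq_trace`): `T U t = limₙ lim_N f_t^{B_N U}(B_N U(t) + i/(n+1))`,
  the Bernstein-driver approximation of the tip limit of Rohde–Schramm (2005), §3 p. 896 and
  Thm. 5.1, exactly as in `SLETraceMeasurable.lean` but at the level of the path space (the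
  node values `U(tk/N)` are measurable for the product σ-algebra, the backward Loewner flow is
  Lipschitz in them, and iterated `limUnder`s of measurable maps into `ℂ` are measurable,
  Mathlib `MeasureTheory.StronglyMeasurable.limUnder`). On the almost sure event of generation,
  `T (W ω) = sleTrace κ ω` and `T (S (W ω)) = s ↦ c · sleTrace κ ω (s/c²)`; hence the two random
  paths are identically distributed (`IdentDistrib.comp`, `IdentDistrib.of_ae_eq`).

As a by-product the whole trace is an a.e.-measurable random path (`aemeasurable_sleTrace_pi`),
strengthening the marginal statement `aemeasurable_sleTrace_holds`.

## References

* G. F. Lawler, *Conformally Invariant Processes in the Plane*, AMS (2005), Prop. 6.5, §4.1.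
* S. Rohde, O. Schramm, *Basic properties of SLE*, Ann. of Math. 161 (2005), Prop. 2.1 (i),
  §3 p. 896, Thm. 5.1.
-/

noncomputable section

open Set Filter Topology MeasureTheory ProbabilityTheory
open scoped NNReal

namespace Literature.Probability.RandomPlanarGeometry

namespace Loewner

variable {U : ℝ≥0 → ℝ}

/-- For a continuous driving function `U`, the backward-flow functional at the Bernstein drivers
of `U` converges to its value at `U`: `f_t^{B_N U}(B_N U(t) + iy) → f_t^U(U(t) + iy)`
(stability of the backward flow, `norm_loewnerInvAt_sub_le`, and uniform Bernstein
approximation, Mathlib `bernsteinApproximation_uniform`). [folklore] -/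
theorem tendsto_loewnerInvAt_bernDriverFun (hU : Continuous U) (t : ℝ≥0) {y : ℝ} (hy : 0 < y) :
    Tendsto (fun N : ℕ ↦ loewnerInvAt t y (bernDriverFun N t (bernNodes N t U))) atTop
      (𝓝 (loewnerInvAt t y U)) := by
  rw [tendsto_iff_norm_sub_tendsto_zero]
  have hbern := bernsteinApproximation_uniform (rescaleDriver U hU t)
  rw [tendsto_iff_norm_sub_tendsto_zero] at hbern
  refine squeeze_zero (fun N ↦ norm_nonneg _) (fun N ↦ norm_loewnerInvAt_sub_le
    (continuous_bernDriverFun N t _) hU t hy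
      fun u hu ↦ abs_bernDriverFun_bernNodes_sub_le hU N t hu) ?_
  simpa using hbern.const_mul (2 * Real.exp (8 / y ^ 2 * t))

/-- The node values `U ↦ (U(tk/N))ₖ` are a measurable map of the path space `ℝ≥0 → ℝ`
(product σ-algebra) to `Fin (N+1) → ℝ`. [folklore] -/
theorem measurable_bernNodes (N : ℕ) (t : ℝ≥0) :
    Measurable fun U : ℝ≥0 → ℝ ↦ bernNodes N t U :=
  measurable_pi_lambda _ fun _ ↦ measurable_pi_apply _

/-- `U ↦ f_t^{B_N U}(B_N U(t) + iy)` is a measurable functional of the path `U` (continuous in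
the finitely many node values). [folklore] -/
theorem measurable_loewnerInvAt_bernDriverFun (N : ℕ) (t : ℝ≥0) {y : ℝ} (hy : 0 < y) :
    Measurable fun U : ℝ≥0 → ℝ ↦ loewnerInvAt t y (bernDriverFun N t (bernNodes N t U)) :=
  (continuous_loewnerInvAt_bernDriverFun N t hy).measurable.comp (measurable_bernNodes N t)

/-- **A measurable version of the Loewner trace functional.** There is a map
`T : (ℝ≥0 → ℝ) → (ℝ≥0 → ℂ)`, measurable for the product σ-algebras, which on every continuous
driving function whose chain is generated by a curve is the Loewner trace:
`T U t = limₙ lim_N f_t^{B_N U}(B_N U(t) + i/(n+1))` (iterated `limUnder`s of measurable maps),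
identified through `tendsto_loewnerInvAt_bernDriverFun` and the tip limit
`γ(t) = limₙ f_t(U(t) + i/(n+1))` (`IsGeneratedByCurve.tendsto_invFunOn_map_seq`).
Rohde–Schramm (2005), §3 p. 896 (measurability of `f̂ₛ`) with Thm. 5.1 (the tip as a boundary
limit). [cite: RohdeSchramm2005, §3 p. 896 and Thm 5.1] -/
theorem exists_measurable_eq_trace :
    ∃ T : (ℝ≥0 → ℝ) → ℝ≥0 → ℂ, Measurable T ∧
      ∀ U : ℝ≥0 → ℝ, Continuous U → (∃ γ, IsGeneratedByCurve U γ) → T U = trace U := by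
  -- the inner limit `N → ∞` (Bernstein approximation), then the outer limit `n → ∞` (tip)
  set F : ℕ → (ℝ≥0 → ℝ) → ℝ≥0 → ℂ := fun n U t ↦
    limUnder atTop fun N : ℕ ↦ loewnerInvAt t ((1 : ℝ) / (n + 1)) (bernDriverFun N t (bernNodes N t U))
    with hF
  set T : (ℝ≥0 → ℝ) → ℝ≥0 → ℂ := fun U t ↦ limUnder atTop fun n : ℕ ↦ F n U t with hT
  have hFm : ∀ n t, Measurable fun U ↦ F n U t := fun n t ↦
    (MeasureTheory.StronglyMeasurable.limUnder (l := atTop) fun N ↦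
      (measurable_loewnerInvAt_bernDriverFun N t (y := (1 : ℝ) / (n + 1))
        (by positivity)).stronglyMeasurable).measurable
  have hTm : Measurable T :=
    measurable_pi_lambda _ fun t ↦ (MeasureTheory.StronglyMeasurable.limUnder (l := atTop)
      fun n ↦ (hFm n t).stronglyMeasurable).measurable
  refine ⟨T, hTm, fun U hU hγ ↦ funext fun t ↦ ?_⟩
  have hgen := isGeneratedByCurve_trace hγ
  -- inner limit
  have hFU : ∀ n : ℕ, F n U t = loewnerInvAt t ((1 : ℝ) / (n + 1)) U := fun n ↦
    (tendsto_loewnerInvAt_bernDriverFun hU t (by positivity)).limUnder_eq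
  -- outer limit
  have hlim : Tendsto (fun n : ℕ ↦ F n U t) atTop (𝓝 (trace U t)) := by
    simp only [hFU, loewnerInvAt_eq]
    exact hgen.tendsto_invFunOn_map_seq hU t
  exact hlim.limUnder_eq

end Loewner

/-! ### SLE scaling in law -/

section Scale

variable {κ : ℝ≥0}

/-- The dilation–time-change `S_c U = (s ↦ c U(s / c²))` of the path space `ℝ≥0 → ℝ` is
measurable (product σ-algebra). [folklore] -/
theorem measurable_pathScale (c : ℝ≥0) :
    Measurable fun (U : ℝ≥0 → ℝ) (s : ℝ≥0) ↦ (c : ℝ) * U (s / c ^ 2) :=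
  measurable_pi_lambda _ fun s ↦ (measurable_pi_apply (s / c ^ 2)).const_mul _

/-- Brownian scaling of the driving function in the form used here: `W = √κ B` and
`s ↦ c W(s / c²)` have the same law on the path space (`identDistrib_sleDriving_scale_holds`
with `c⁻¹`). Rohde–Schramm (2005), Prop. 2.1 (i). [cite: RohdeSchramm2005, Prop. 2.1] -/
theorem identDistrib_sleDriving_scale' (κ : ℝ≥0) {c : ℝ≥0} (hc : c ≠ 0) :
    IdentDistrib (fun ω ↦ sleDriving κ ω) (fun ω s ↦ (c : ℝ) * sleDriving κ ω (s / c ^ 2))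
      Process.preWienerMeasure Process.preWienerMeasure := by
  have h := identDistrib_sleDriving_scale_holds κ (c := c⁻¹) (inv_ne_zero hc)
  have h1 : ((c⁻¹ : ℝ≥0) : ℝ)⁻¹ = c := by rw [NNReal.coe_inv, inv_inv]
  have h2 : ∀ s : ℝ≥0, (c⁻¹) ^ 2 * s = s / c ^ 2 := fun s ↦ by
    rw [inv_pow, mul_comm, div_eq_mul_inv]
  simpa only [h1, h2] using h

/-- **SLE scaling in law, for every `κ` with a trace.** If SLE_κ is a.s. generated by a curve,
then for `c > 0` the random paths `t ↦ γ(t)` and `t ↦ c γ(t / c²)` (`γ = sleTrace κ ω`) have the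
same law on `ℝ≥0 → ℂ` (product σ-algebra). Proof: push Brownian scaling of the driving function
(`identDistrib_sleDriving_scale'`) through the measurable trace functional of
`Loewner.exists_measurable_eq_trace`, and identify both sides a.s. by the deterministic scaling of
the trace (`Loewner.trace_scale_of_unique`, `Loewner.IsGeneratedByCurve.unique_holds`).
Lawler (2005), Prop. 6.5; Rohde–Schramm (2005), Prop. 2.1 (i).
[cite: Lawler2005, Prop. 6.5] [cite: RohdeSchramm2005, Prop. 2.1(i)] -/
theorem identDistrib_sleTrace_scale_of_hasSLETrace (hκ : HasSLETrace κ) {c : ℝ≥0} (hc : c ≠ 0) :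
    IdentDistrib (fun ω ↦ sleTrace κ ω) (fun ω t ↦ (c : ℂ) * sleTrace κ ω (t / c ^ 2))
      Process.preWienerMeasure Process.preWienerMeasure := by
  obtain ⟨T, hTm, hT⟩ := Loewner.exists_measurable_eq_trace
  set S : (ℝ≥0 → ℝ) → ℝ≥0 → ℝ := fun U s ↦ (c : ℝ) * U (s / c ^ 2) with hS
  have hSm : Measurable S := measurable_pathScale c
  have hW : Measurable fun ω : ℝ≥0 → ℝ ↦ sleDriving κ ω := measurable_sleDriving_pi κ
  -- Brownian scaling pushed through `T`
  have hmid : IdentDistrib (T ∘ fun ω ↦ sleDriving κ ω) (T ∘ (S ∘ fun ω ↦ sleDriving κ ω))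
      Process.preWienerMeasure Process.preWienerMeasure :=
    (identDistrib_sleDriving_scale' κ hc).comp hTm
  -- a.s. identification of the two sides
  have h1 : (T ∘ fun ω ↦ sleDriving κ ω) =ᵐ[Process.preWienerMeasure] fun ω ↦ sleTrace κ ω := by
    filter_upwards [hκ] with ω hω
    exact hT _ (continuous_sleDriving κ ω) hω
  have h2 : (T ∘ (S ∘ fun ω ↦ sleDriving κ ω)) =ᵐ[Process.preWienerMeasure]
      fun ω t ↦ (c : ℂ) * sleTrace κ ω (t / c ^ 2) := by
    filter_upwards [hκ] with ω hω
    have hcont : Continuous (S (sleDriving κ ω)) :=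
      continuous_const.mul ((continuous_sleDriving κ ω).comp (continuous_id.div_const _))
    have hgen : ∃ γ, Loewner.IsGeneratedByCurve (S (sleDriving κ ω)) γ :=
      ⟨_, (Loewner.isGeneratedByCurve_trace hω).scale hc⟩
    simp only [Function.comp_apply]
    rw [hT _ hcont hgen]
    exact Loewner.trace_scale_of_unique Loewner.IsGeneratedByCurve.unique_holds hc
      (continuous_sleDriving κ ω) hω
  exact ((IdentDistrib.of_ae_eq (hTm.comp hW).aemeasurable h1).symm.trans hmid).trans
    (IdentDistrib.of_ae_eq (hTm.comp (hSm.comp hW)).aemeasurable h2)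

/-- **The SLE_κ trace is an a.e.-measurable random path** (whole path, product σ-algebra on
`ℝ≥0 → ℂ`) as soon as SLE_κ is a.s. generated by a curve; this strengthens the marginal
statement `aemeasurable_sleTrace_holds`. Rohde–Schramm (2005), §3 p. 896 with Thm. 5.1.
[cite: RohdeSchramm2005, §3 p. 896] -/
theorem aemeasurable_sleTrace_pi (hκ : HasSLETrace κ) :
    AEMeasurable (fun ω ↦ sleTrace κ ω) Process.preWienerMeasure :=
  (identDistrib_sleTrace_scale_of_hasSLETrace hκ one_ne_zero).aemeasurable_fst

/-- `identDistrib_sleTrace_scale` (SLE scaling in law for **every** `κ : ℝ≥0`) holds as soon as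
every SLE_κ is generated by a curve. Lawler (2005), Prop. 6.5. [cite: Lawler2005, Prop. 6.5] -/
theorem identDistrib_sleTrace_scale_of_forall_hasSLETrace (h : ∀ κ : ℝ≥0, HasSLETrace κ) :
    identDistrib_sleTrace_scale :=
  fun κ _ hc ↦ identDistrib_sleTrace_scale_of_hasSLETrace (h κ) hc

/-- **`identDistrib_sleTrace_scale` from the two SLE trace theorems**: SLE₈ is generated by a
curve (`hasSLETrace_eight`, Lawler–Schramm–Werner (2004), Thm. 4.7) and SLE_κ, `κ ≠ 8`, is
generated by a curve (`hasSLETrace_of_ne_eight`, Rohde–Schramm (2005), Thm. 5.1). Everything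
else — Brownian scaling, scaling of the Loewner flow and hulls, uniqueness of the generating
curve, measurability of the trace functional — is proved in this library.
Lawler (2005), Prop. 6.5. [cite: Lawler2005, Prop. 6.5] -/
theorem identDistrib_sleTrace_scale_of_trace_theorems (h8 : hasSLETrace_eight)
    (hne : hasSLETrace_of_ne_eight) : identDistrib_sleTrace_scale :=
  identDistrib_sleTrace_scale_of_forall_hasSLETrace (hasSLETrace h8 hne)

end Scale

end Literature.Probability.RandomPlanarGeometry

end
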